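import Literature.Geometry.Kaehler.ComplexTorusIntegralCoLefschetzMinimalClassCokernels
import Literature.Geometry.Kaehler.ComplexTorusIntegralHardLefschetzMinimalClassDegreeTwo
import Mathlib.GroupTheory.SpecificGroups.Cyclic
import HarnessLib

/-!
# The torsion exponents of the integral hard-Lefschetz cokernels of a polarised complex torus:
# `d_g/d₁` kills `H^{2g−1}(X, ℤ)/γ_{g−1} ∧ H¹(X, ℤ)`, `d_{g−1}/d₁` kills `H^{2g−1}(X, ℤ)/γ_{g−2} ∧ H³(X, ℤ)`, and both are optimal

Layer `Literature/Geometry/Kaehler`, namespace `Literature.Geometry.Kaehler.ComplexTorus`; lane `lit-hodgefound` (Track 2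
foundations library), seat p09, generation 41, row g41-#5. THEOREMS ONLY (0 definitions); no named fact, net debt 0. Sequel of
g40-#5 `ComplexTorusIntegralCoLefschetzMinimalClassCokernels` (the cokernels as groups: `H^{2g−1}(X, ℤ)/γ_{g−1} ∧ H¹(X, ℤ) ≃+ ⊕_x ℤ/(d_g/d_{a(x)})`,
`H^{2g−1}(X, ℤ)/γ_{g−2} ∧ H³(X, ℤ) ≃+ ⊕_x ℤ/(d_{g−1}/d_{min(a(x), g−1)})`) and g40-#6 `ComplexTorusIntegralHardLefschetzMinimalClassDegreeTwo`
(constant type: `H^{2g−2}(X, ℤ)/γ_{g−2} ∧ H²(X, ℤ) ≃+ ℤ/(g−1)`).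

Sources (the statements being made precise over `ℤ`):

* Lange 2023 §5.4.1 Thm. 5.4.1 (PDF p. 275: hard Lefschetz over `ℂ`) and (5.22), §2.5.3 Thm. 2.5.16 / Cor. 2.5.17 (PDF p. 135), §1.5.1 (PDF p. 51:
  types `d₁ ∣ ⋯ ∣ d_g`), §4.2 (PDF p. 204: Poincaré's formula);
* Voisin 2002 §7.1.2 (PDF p. 134 L31: the Lefschetz operator acts on integral cohomology; hard Lefschetz fails over `ℤ` in general);
* Adkins–Weintraub 1992 Ch. 3 §7 Thm. (7.1) and Rem. (7.10) (the exponent `me(M)` of `⊕ ℤ/mⱼ`, `m₁ ∣ ⋯ ∣ m_t`, is the last invariant factor).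

THE POINT. The EXPONENT of a finite abelian group `⊕_x ℤ/n_x` is `lcm_x n_x`; over a type `d₁ ∣ d₂ ∣ ⋯ ∣ d_g` every ratio `d_g/d_a` divides
`d_g/d₁` and every `d_{g−1}/d_a` (`a ≤ g−1`) divides `d_{g−1}/d₁`. Hence (`g = j + 2`, symplectic presentation or any presentation):

  **`AddMonoid.exponent (H^{2g−1}(X, ℤ)/γ_{g−1} ∧ H¹(X, ℤ)) = d_g/d₁`** and **`AddMonoid.exponent (H^{2g−1}(X, ℤ)/γ_{g−2} ∧ H³(X, ℤ)) = d_{g−1}/d₁`**;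

equivalently `N·H^{2g−1}(X, ℤ) ⊆ γ_{g−1} ∧ H¹(X, ℤ) ⟺ d_g/d₁ ∣ N` and `N·H^{2g−1}(X, ℤ) ⊆ γ_{g−2} ∧ H³(X, ℤ) ⟺ d_{g−1}/d₁ ∣ N`: the minimal
class `γ_{g−1}` inverts hard Lefschetz in degree one over `ℤ[d₁/d_g]` and over no smaller localisation (compare the ORDER `∏_a (d_g/d_a)²` of
g40-#5). Constant type, degree two: the exponent of `H^{2g−2}(X, ℤ)/γ_{g−2} ∧ H²(X, ℤ) ≅ ℤ/(g−1)` is `g − 1`.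

## Contents (theorems only; `g = j + 2`)

* §0 (private) exponents of quotients `H/S` inside an ambient group (`N·H ⊆ S ⟺ exponent ∣ N`); the `lcm` of the ratios of a type.
* §1 `IsSymplecticEnum.exponent_quotient_map_wedge_integralForms_one_of_eq_content_smul` (`= d_g/d₁`),
  `…nsmul_mem_map_wedge_integralForms_one_of_eq_content_smul` (`(d_g/d₁)·y ∈ γ_{g−1} ∧ H¹(X, ℤ)`),
  `…map_nsmul_le_map_wedge_integralForms_one_iff_of_eq_content_smul` (`N·H^{2g−1} ⊆ γ_{g−1} ∧ H¹ ⟺ d_g/d₁ ∣ N`).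
* §2 the same three for `γ_{g−2} ∧ H³(X, ℤ)` with `d_{g−1}/d₁`.
* §3 constant type, degree two: exponent `g − 1`; `(g−1)·H^{2g−2}(X, ℤ) ⊆ γ_{g−2} ∧ H²(X, ℤ)`; `N·H^{2g−2} ⊆ γ_{g−2} ∧ H² ⟺ g−1 ∣ N`.
* §4 basis-free forms (`IsPolarizationType`, any presentation) and existence forms.

## References

* [cite: Lange2023AbelianVarietiesComplex, §5.4.1 Thm. 5.4.1 and (5.22) (PDF p. 275); §2.5.3 Thm. 2.5.16 and Cor. 2.5.17 (PDF p. 135); §1.5.1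
  (PDF p. 51); §4.2 (PDF p. 204)]
* [cite: VoisinHodgeI2002, §7.1.2 (PDF p. 134 L31); §7.2.2 (PDF p. 142 L10)]
* [cite: AdkinsWeintraub1992, Ch. 3 §7 Thm. (7.1) and Rem. (7.10)]
-/

noncomputable section

open Module Function
open Literature.LinearAlgebra.Alternating

namespace Literature.Geometry.Kaehler.ComplexTorus

/-! ## §0 Exponents of sub-quotients; the `lcm` of the ratios of a type (private) -/

section Exponent

variable {G : Type*} [AddCommGroup G] {H S : AddSubgroup G}

/-- If the exponent of `H/(S ∩ H)` is `N` then `N·y ∈ S` for every `y ∈ H`. [cite: AdkinsWeintraub1992, Ch. 3 §7 Thm. (7.1)] -/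
private theorem nsmul_mem_of_exponent_eq₄₆ {N : ℕ} (hN : AddMonoid.exponent (↥H ⧸ S.addSubgroupOf H) = N) {y : G} (hy : y ∈ H) :
    N • y ∈ S := by
  have h := AddMonoid.exponent_nsmul_eq_zero (G := ↥H ⧸ S.addSubgroupOf H) (QuotientAddGroup.mk ⟨y, hy⟩)
  rwa [hN, ← QuotientAddGroup.mk_nsmul, QuotientAddGroup.eq_zero_iff, AddSubgroup.mem_addSubgroupOf] at h

/-- If `N·y ∈ S` for every `y ∈ H` then the exponent of `H/(S ∩ H)` divides `N`. [cite: AdkinsWeintraub1992, Ch. 3 §7 Thm. (7.1)] -/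
private theorem exponent_dvd_of_forall_nsmul_mem₄₆ {N : ℕ} (h : ∀ y ∈ H, N • y ∈ S) :
    AddMonoid.exponent (↥H ⧸ S.addSubgroupOf H) ∣ N := by
  refine AddMonoid.exponent_dvd_of_forall_nsmul_eq_zero fun q ↦ ?_
  obtain ⟨⟨y, hy⟩, rfl⟩ := QuotientAddGroup.mk_surjective q
  rw [← QuotientAddGroup.mk_nsmul, QuotientAddGroup.eq_zero_iff, AddSubgroup.mem_addSubgroupOf]
  exact h y hy

/-- `N·H ⊆ S ⟺ exponent(H/(S ∩ H)) ∣ N`. [cite: AdkinsWeintraub1992, Ch. 3 §7 Thm. (7.1) and Rem. (7.10)] -/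
private theorem map_nsmul_le_iff_exponent_dvd₄₆ {e : ℕ} (he : AddMonoid.exponent (↥H ⧸ S.addSubgroupOf H) = e) (N : ℕ) :
    H.map (nsmulAddMonoidHom N) ≤ S ↔ e ∣ N := by
  constructor
  · intro hle
    exact he ▸ exponent_dvd_of_forall_nsmul_mem₄₆ fun y hy ↦ hle ⟨y, hy, rfl⟩
  · rintro ⟨c, rfl⟩ _ ⟨y, hy, rfl⟩
    rw [nsmulAddMonoidHom_apply, mul_nsmul]
    exact S.nsmul_mem (nsmul_mem_of_exponent_eq₄₆ he hy) c

/-- `c/b ∣ c/a` for `a ∣ b ∣ c` (positive). [folklore] -/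
private theorem div_dvd_div₄₆ {a b c : ℕ} (hab : a ∣ b) (hbc : b ∣ c) (ha : 0 < a) (hb : 0 < b) : c / b ∣ c / a := by
  obtain ⟨u, rfl⟩ := hbc
  obtain ⟨v, rfl⟩ := hab
  rw [Nat.mul_div_cancel_left _ hb, mul_assoc, Nat.mul_div_cancel_left _ ha]
  exact Dvd.intro_left _ rfl

/-- The `lcm` of the ratios `d_T/d_{f(x)}` over a family meeting the bottom index `i₀` (`d_{i₀} ∣ d_{f(x)} ∣ d_T`) is `d_T/d_{i₀}`.
[cite: AdkinsWeintraub1992, Ch. 3 §7 Rem. (7.10)] -/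
private theorem lcm_univ_div_eq₄₆ {g : ℕ} {d : Fin g → ℕ} (hpos : ∀ a, 0 < d a) {κ : Type*} [Fintype κ] {f : κ → Fin g} {T i₀ : Fin g}
    (hT : ∀ x, d (f x) ∣ d T) (h0 : ∀ x, d i₀ ∣ d (f x)) {x₀ : κ} (hx₀ : f x₀ = i₀) :
    Finset.univ.lcm (fun x ↦ d T / d (f x)) = d T / d i₀ := by
  refine Nat.dvd_antisymm (Finset.lcm_dvd fun x _ ↦ div_dvd_div₄₆ (h0 x) (hT x) (hpos _) (hpos _)) ?_
  have h := Finset.dvd_lcm (s := Finset.univ) (f := fun x ↦ d T / d (f x)) (Finset.mem_univ x₀)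
  rwa [hx₀] at h

/-- The exponent of `⊕_x ℤ/(d_T/d_{f(x)})` is `d_T/d_{i₀}` under the hypotheses of `lcm_univ_div_eq₄₆`.
[cite: AdkinsWeintraub1992, Ch. 3 §7 Thm. (7.1) and Rem. (7.10)] -/
private theorem exponent_pi_zmod_div_eq₄₆ {g : ℕ} {d : Fin g → ℕ} (hpos : ∀ a, 0 < d a) {κ : Type*} [Fintype κ] {f : κ → Fin g}
    {T i₀ : Fin g} (hT : ∀ x, d (f x) ∣ d T) (h0 : ∀ x, d i₀ ∣ d (f x)) {x₀ : κ} (hx₀ : f x₀ = i₀) :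
    AddMonoid.exponent ((x : κ) → ZMod (d T / d (f x))) = d T / d i₀ := by
  rw [AddMonoid.exponent_pi, ← lcm_univ_div_eq₄₆ hpos hT h0 hx₀]
  exact congrArg _ (funext fun x ↦ ZMod.exponent _)

end Exponent

section HardLefschetzExponents

variable {ι : Type*} [Fintype ι] [DecidableEq ι] {E : Type*} [NormedAddCommGroup E] [NormedSpace ℂ E]
  (Φ : (ι → ℝ) ≃L[ℝ] E) {j : ℕ} {e₀ : Fin (j + 2) ⊕ Fin (j + 2) ≃ ι} {η : E [⋀^Fin 2]→L[ℝ] ℝ} {d : Fin (j + 2) → ℕ}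

/-! ## §1 Degree one: the exponent of `H^{2g−1}(X, ℤ)/γ_{g−1} ∧ H¹(X, ℤ)` is `d_g/d₁` -/

/-- **The torsion exponent of integral hard Lefschetz in degree one is `d_g/d₁`.** Let `η` be a Riemann form of type `(d₁, …, d_g)` on
`X = E/Φ(ℤ^ι)` with a symplectic enumeration (`g = j + 2`) and `m` the minimal class `γ_{g−1}`, `θ^{∧(g−1)} = ((g−1)!·d₁⋯d_{g−1})·m`. Then
`AddMonoid.exponent (H^{2g−1}(X, ℤ)/γ_{g−1} ∧ H¹(X, ℤ)) = d_g/d₁`: the cokernel is `⊕_x ℤ/(d_g/d_{a(x)})` (g40-#5) and every `d_g/d_a` divides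
`d_g/d₁`, attained at the letters of index `1`. [cite: Lange2023AbelianVarietiesComplex, §5.4.1 Thm. 5.4.1 and (5.22) (PDF p. 275); §2.5.3 Cor. 2.5.17 (PDF p. 135); §1.5.1 (PDF p. 51)] [cite: VoisinHodgeI2002, §7.2.2 (PDF p. 142 L10)] [cite: AdkinsWeintraub1992, Ch. 3 §7 Thm. (7.1) and Rem. (7.10)] -/
theorem IsSymplecticEnum.exponent_quotient_map_wedge_integralForms_one_of_eq_content_smul (h : IsSymplecticEnum Φ e₀ η d)
    (hη : IsRiemannForm Φ η) (hle₁ : j + 1 ≤ j + 2) {m : E [⋀^Fin (2 * (j + 1))]→L[ℝ] ℂ}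
    (hm : wedgePow (ofRealForm η) (j + 1) = (((j + 1).factorial * ∏ i : Fin (j + 1), d (Fin.castLE hle₁ i) : ℕ) : ℂ) • m) :
    AddMonoid.exponent (↥(integralForms Φ (2 * j + 3)) ⧸ ((integralForms Φ 1).map (AddMonoidHom.mk'
        (fun x : E [⋀^Fin 1]→L[ℝ] ℂ ↦ (m.wedge x : E [⋀^Fin (2 * j + 3)]→L[ℝ] ℂ))
        (ContinuousAlternatingMap.wedge_add_right _))).addSubgroupOf (integralForms Φ (2 * j + 3))) =
      d (Fin.last (j + 1)) / d 0 := by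
  obtain ⟨e⟩ := h.nonempty_addEquiv_quotient_map_wedge_integralForms_one_of_eq_content_smul Φ hη hle₁ hm
  rw [AddMonoid.exponent_eq_of_addEquiv e]
  exact exponent_pi_zmod_div_eq₄₆ (h.pos hη) (fun x ↦ h.dvd _ _ (Fin.le_last _)) (fun x ↦ h.dvd _ _ (Fin.zero_le _))
    (x₀ := Sum.inl 0) rfl

/-- **`(d_g/d₁)·H^{2g−1}(X, ℤ) ⊆ γ_{g−1} ∧ H¹(X, ℤ)`**: every integral top-but-one class becomes a `γ_{g−1}`-multiple of an integral `1`-class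
after multiplication by `d_g/d₁` (`g = j + 2`). [cite: Lange2023AbelianVarietiesComplex, §5.4.1 Thm. 5.4.1 and (5.22) (PDF p. 275); §1.5.1 (PDF p. 51)] [cite: VoisinHodgeI2002, §7.2.2 (PDF p. 142 L10)] -/
theorem IsSymplecticEnum.nsmul_mem_map_wedge_integralForms_one_of_eq_content_smul (h : IsSymplecticEnum Φ e₀ η d)
    (hη : IsRiemannForm Φ η) (hle₁ : j + 1 ≤ j + 2) {m : E [⋀^Fin (2 * (j + 1))]→L[ℝ] ℂ}
    (hm : wedgePow (ofRealForm η) (j + 1) = (((j + 1).factorial * ∏ i : Fin (j + 1), d (Fin.castLE hle₁ i) : ℕ) : ℂ) • m)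
    {y : E [⋀^Fin (2 * j + 3)]→L[ℝ] ℂ} (hy : y ∈ integralForms Φ (2 * j + 3)) :
    (d (Fin.last (j + 1)) / d 0) • y ∈ (integralForms Φ 1).map (AddMonoidHom.mk'
        (fun x : E [⋀^Fin 1]→L[ℝ] ℂ ↦ (m.wedge x : E [⋀^Fin (2 * j + 3)]→L[ℝ] ℂ)) (ContinuousAlternatingMap.wedge_add_right _)) :=
  nsmul_mem_of_exponent_eq₄₆ (h.exponent_quotient_map_wedge_integralForms_one_of_eq_content_smul Φ hη hle₁ hm) hy

/-- **`N·H^{2g−1}(X, ℤ) ⊆ γ_{g−1} ∧ H¹(X, ℤ) ⟺ d_g/d₁ ∣ N`** — `d_g/d₁` is the optimal denominator for inverting hard Lefschetz in degree one with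
the minimal class (`g = j + 2`). [cite: Lange2023AbelianVarietiesComplex, §5.4.1 Thm. 5.4.1 and (5.22) (PDF p. 275); §1.5.1 (PDF p. 51)] [cite: VoisinHodgeI2002, §7.2.2 (PDF p. 142 L10)] [cite: AdkinsWeintraub1992, Ch. 3 §7 Rem. (7.10)] -/
theorem IsSymplecticEnum.map_nsmul_le_map_wedge_integralForms_one_iff_of_eq_content_smul (h : IsSymplecticEnum Φ e₀ η d)
    (hη : IsRiemannForm Φ η) (hle₁ : j + 1 ≤ j + 2) {m : E [⋀^Fin (2 * (j + 1))]→L[ℝ] ℂ}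
    (hm : wedgePow (ofRealForm η) (j + 1) = (((j + 1).factorial * ∏ i : Fin (j + 1), d (Fin.castLE hle₁ i) : ℕ) : ℂ) • m) (N : ℕ) :
    (integralForms Φ (2 * j + 3)).map (nsmulAddMonoidHom N) ≤ (integralForms Φ 1).map (AddMonoidHom.mk'
        (fun x : E [⋀^Fin 1]→L[ℝ] ℂ ↦ (m.wedge x : E [⋀^Fin (2 * j + 3)]→L[ℝ] ℂ)) (ContinuousAlternatingMap.wedge_add_right _)) ↔
      d (Fin.last (j + 1)) / d 0 ∣ N :=
  map_nsmul_le_iff_exponent_dvd₄₆ (h.exponent_quotient_map_wedge_integralForms_one_of_eq_content_smul Φ hη hle₁ hm) N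

/-! ## §2 The co-Lefschetz map on `H³`: the exponent of `H^{2g−1}(X, ℤ)/γ_{g−2} ∧ H³(X, ℤ)` is `d_{g−1}/d₁` -/

/-- **The torsion exponent of `H^{2g−1}(X, ℤ)/γ_{g−2} ∧ H³(X, ℤ)` is `d_{g−1}/d₁`** (`g = j + 2`, `θ^{∧(g−2)} = ((g−2)!·d₁⋯d_{g−2})·γ`): the
cokernel is `⊕_x ℤ/(d_{g−1}/d_{min(a(x), g−1)})` (g40-#5) and every such ratio divides `d_{g−1}/d₁`.
[cite: Lange2023AbelianVarietiesComplex, §5.4.1 Thm. 5.4.1 and (5.22) (PDF p. 275); §2.5.3 Thm. 2.5.16 (PDF p. 135); §1.5.1 (PDF p. 51)] [cite: VoisinHodgeI2002, §7.1.2 (PDF p. 134 L31)] [cite: AdkinsWeintraub1992, Ch. 3 §7 Thm. (7.1) and Rem. (7.10)] -/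
theorem IsSymplecticEnum.exponent_quotient_map_wedge_integralForms_three_of_eq_content_smul (h : IsSymplecticEnum Φ e₀ η d)
    (hη : IsRiemannForm Φ η) (hle₂ : j ≤ j + 2) {γ : E [⋀^Fin (2 * j)]→L[ℝ] ℂ}
    (hγ : wedgePow (ofRealForm η) j = ((j.factorial * ∏ i : Fin j, d (Fin.castLE hle₂ i) : ℕ) : ℂ) • γ) :
    AddMonoid.exponent (↥(integralForms Φ (2 * j + 3)) ⧸ ((integralForms Φ 3).map (AddMonoidHom.mk'
        (fun x : E [⋀^Fin 3]→L[ℝ] ℂ ↦ γ.wedge x) (ContinuousAlternatingMap.wedge_add_right _))).addSubgroupOf (integralForms Φ (2 * j + 3))) =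
      d (Fin.last j).castSucc / d 0 := by
  obtain ⟨e⟩ := h.nonempty_addEquiv_quotient_map_wedge_integralForms_three_of_eq_content_smul Φ hη hle₂ hγ
  rw [AddMonoid.exponent_eq_of_addEquiv e]
  refine exponent_pi_zmod_div_eq₄₆ (h.pos hη) (fun x ↦ ?_) (fun x ↦ h.dvd _ _ (Fin.zero_le _)) (x₀ := Sum.inl 0) ?_
  · split_ifs with hx
    · exact dvd_rfl
    · exact h.dvd _ _ (Fin.le_castSucc_iff.2 ((Fin.le_last _).lt_of_ne hx))
  · simp

/-- **`(d_{g−1}/d₁)·H^{2g−1}(X, ℤ) ⊆ γ_{g−2} ∧ H³(X, ℤ)`** (`g = j + 2`). [cite: Lange2023AbelianVarietiesComplex, §5.4.1 Thm. 5.4.1 and (5.22) (PDF p. 275); §1.5.1 (PDF p. 51)] [cite: VoisinHodgeI2002, §7.1.2 (PDF p. 134 L31)] -/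
theorem IsSymplecticEnum.nsmul_mem_map_wedge_integralForms_three_of_eq_content_smul (h : IsSymplecticEnum Φ e₀ η d)
    (hη : IsRiemannForm Φ η) (hle₂ : j ≤ j + 2) {γ : E [⋀^Fin (2 * j)]→L[ℝ] ℂ}
    (hγ : wedgePow (ofRealForm η) j = ((j.factorial * ∏ i : Fin j, d (Fin.castLE hle₂ i) : ℕ) : ℂ) • γ)
    {y : E [⋀^Fin (2 * j + 3)]→L[ℝ] ℂ} (hy : y ∈ integralForms Φ (2 * j + 3)) :
    (d (Fin.last j).castSucc / d 0) • y ∈ (integralForms Φ 3).map (AddMonoidHom.mk'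
        (fun x : E [⋀^Fin 3]→L[ℝ] ℂ ↦ γ.wedge x) (ContinuousAlternatingMap.wedge_add_right _)) :=
  nsmul_mem_of_exponent_eq₄₆ (h.exponent_quotient_map_wedge_integralForms_three_of_eq_content_smul Φ hη hle₂ hγ) hy

/-- **`N·H^{2g−1}(X, ℤ) ⊆ γ_{g−2} ∧ H³(X, ℤ) ⟺ d_{g−1}/d₁ ∣ N`** (`g = j + 2`). [cite: Lange2023AbelianVarietiesComplex, §5.4.1 Thm. 5.4.1 and (5.22) (PDF p. 275); §1.5.1 (PDF p. 51)] [cite: VoisinHodgeI2002, §7.1.2 (PDF p. 134 L31)] [cite: AdkinsWeintraub1992, Ch. 3 §7 Rem. (7.10)] -/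
theorem IsSymplecticEnum.map_nsmul_le_map_wedge_integralForms_three_iff_of_eq_content_smul (h : IsSymplecticEnum Φ e₀ η d)
    (hη : IsRiemannForm Φ η) (hle₂ : j ≤ j + 2) {γ : E [⋀^Fin (2 * j)]→L[ℝ] ℂ}
    (hγ : wedgePow (ofRealForm η) j = ((j.factorial * ∏ i : Fin j, d (Fin.castLE hle₂ i) : ℕ) : ℂ) • γ) (N : ℕ) :
    (integralForms Φ (2 * j + 3)).map (nsmulAddMonoidHom N) ≤ (integralForms Φ 3).map (AddMonoidHom.mk'
        (fun x : E [⋀^Fin 3]→L[ℝ] ℂ ↦ γ.wedge x) (ContinuousAlternatingMap.wedge_add_right _)) ↔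
      d (Fin.last j).castSucc / d 0 ∣ N :=
  map_nsmul_le_iff_exponent_dvd₄₆ (h.exponent_quotient_map_wedge_integralForms_three_of_eq_content_smul Φ hη hle₂ hγ) N

/-! ## §3 Constant type, degree two: the exponent of `H^{2g−2}(X, ℤ)/γ_{g−2} ∧ H²(X, ℤ) ≅ ℤ/(g−1)` is `g − 1` -/

/-- **Constant type `(k, …, k)`: the exponent of `H^{2g−2}(X, ℤ)/γ_{g−2} ∧ H²(X, ℤ)` is `g − 1`** (`g = j + 2`; the quotient is cyclic of
order `g − 1`, g40-#6; e.g. every principally polarised torus). [cite: Lange2023AbelianVarietiesComplex, §4.2 (PDF p. 204); §2.5.3 Cor. 2.5.17 (PDF p. 135); §5.4.1 Thm. 5.4.1 and (5.22) (PDF p. 275)] [cite: VoisinHodgeI2002, §7.1.2 (PDF p. 134 L31)] [cite: AdkinsWeintraub1992, Ch. 3 §7 Rem. (7.10)] -/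
theorem IsSymplecticEnum.exponent_quotient_map_wedge_integralForms_two_of_forall_eq (h : IsSymplecticEnum Φ e₀ η d)
    (hη : IsRiemannForm Φ η) (hle : j ≤ j + 2) {γ : E [⋀^Fin (2 * j)]→L[ℝ] ℂ}
    (hγ : wedgePow (ofRealForm η) j = ((j.factorial * ∏ i : Fin j, d (Fin.castLE hle i) : ℕ) : ℂ) • γ) (hd : ∀ i, d i = d 0) :
    AddMonoid.exponent (↥(integralForms Φ (2 * j + 2)) ⧸ ((integralForms Φ 2).map (AddMonoidHom.mk' (fun x : E [⋀^Fin 2]→L[ℝ] ℂ ↦ γ.wedge x)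
        (ContinuousAlternatingMap.wedge_add_right _))).addSubgroupOf (integralForms Φ (2 * j + 2))) = j + 1 := by
  obtain ⟨e⟩ := h.nonempty_addEquiv_quotient_map_wedge_integralForms_two_zmod_of_eq_content_smul Φ hη hle hγ hd
  rw [AddMonoid.exponent_eq_of_addEquiv e, ZMod.exponent]

/-- **Constant type: `(g−1)·H^{2g−2}(X, ℤ) ⊆ γ_{g−2} ∧ H²(X, ℤ)`** (`g = j + 2`). [cite: Lange2023AbelianVarietiesComplex, §4.2 (PDF p. 204); §5.4.1 Thm. 5.4.1 and (5.22) (PDF p. 275)] [cite: VoisinHodgeI2002, §7.1.2 (PDF p. 134 L31)] -/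
theorem IsSymplecticEnum.succ_nsmul_mem_map_wedge_integralForms_two_of_forall_eq (h : IsSymplecticEnum Φ e₀ η d)
    (hη : IsRiemannForm Φ η) (hle : j ≤ j + 2) {γ : E [⋀^Fin (2 * j)]→L[ℝ] ℂ}
    (hγ : wedgePow (ofRealForm η) j = ((j.factorial * ∏ i : Fin j, d (Fin.castLE hle i) : ℕ) : ℂ) • γ) (hd : ∀ i, d i = d 0)
    {y : E [⋀^Fin (2 * j + 2)]→L[ℝ] ℂ} (hy : y ∈ integralForms Φ (2 * j + 2)) :
    (j + 1) • y ∈ (integralForms Φ 2).map (AddMonoidHom.mk' (fun x : E [⋀^Fin 2]→L[ℝ] ℂ ↦ γ.wedge x)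
        (ContinuousAlternatingMap.wedge_add_right _)) :=
  nsmul_mem_of_exponent_eq₄₆ (h.exponent_quotient_map_wedge_integralForms_two_of_forall_eq Φ hη hle hγ hd) hy

/-- **Constant type: `N·H^{2g−2}(X, ℤ) ⊆ γ_{g−2} ∧ H²(X, ℤ) ⟺ g − 1 ∣ N`** (`g = j + 2`). [cite: Lange2023AbelianVarietiesComplex, §4.2 (PDF p. 204); §5.4.1 Thm. 5.4.1 and (5.22) (PDF p. 275)] [cite: VoisinHodgeI2002, §7.1.2 (PDF p. 134 L31)] [cite: AdkinsWeintraub1992, Ch. 3 §7 Rem. (7.10)] -/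
theorem IsSymplecticEnum.map_nsmul_le_map_wedge_integralForms_two_iff_of_forall_eq (h : IsSymplecticEnum Φ e₀ η d)
    (hη : IsRiemannForm Φ η) (hle : j ≤ j + 2) {γ : E [⋀^Fin (2 * j)]→L[ℝ] ℂ}
    (hγ : wedgePow (ofRealForm η) j = ((j.factorial * ∏ i : Fin j, d (Fin.castLE hle i) : ℕ) : ℂ) • γ) (hd : ∀ i, d i = d 0) (N : ℕ) :
    (integralForms Φ (2 * j + 2)).map (nsmulAddMonoidHom N) ≤ (integralForms Φ 2).map (AddMonoidHom.mk' (fun x : E [⋀^Fin 2]→L[ℝ] ℂ ↦ γ.wedge x)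
        (ContinuousAlternatingMap.wedge_add_right _)) ↔ j + 1 ∣ N :=
  map_nsmul_le_iff_exponent_dvd₄₆ (h.exponent_quotient_map_wedge_integralForms_two_of_forall_eq Φ hη hle hγ hd) N

/-! ## §4 Basis-free forms: any presentation of a polarised torus of type `(d₁, …, d_g)` -/

/-- **Any presentation: the exponent of `H^{2g−1}(X, ℤ)/γ_{g−1} ∧ H¹(X, ℤ)` is `d_g/d₁`** (`g = j + 2`).
[cite: Lange2023AbelianVarietiesComplex, §5.4.1 Thm. 5.4.1 and (5.22) (PDF p. 275); §1.5.1 (PDF p. 51)] [cite: VoisinHodgeI2002, §7.2.2 (PDF p. 142 L10)] [cite: AdkinsWeintraub1992, Ch. 3 §7 Thm. (7.1) and Rem. (7.10)] -/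
theorem IsPolarizationType.exponent_quotient_map_wedge_integralForms_one_of_eq_content_smul {Φ : (ι → ℝ) ≃L[ℝ] E}
    (hd : IsPolarizationType Φ η d) (hη : IsRiemannForm Φ η) (hle₁ : j + 1 ≤ j + 2) {m : E [⋀^Fin (2 * (j + 1))]→L[ℝ] ℂ}
    (hm : wedgePow (ofRealForm η) (j + 1) = (((j + 1).factorial * ∏ i : Fin (j + 1), d (Fin.castLE hle₁ i) : ℕ) : ℂ) • m) :
    AddMonoid.exponent (↥(integralForms Φ (2 * j + 3)) ⧸ ((integralForms Φ 1).map (AddMonoidHom.mk'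
        (fun x : E [⋀^Fin 1]→L[ℝ] ℂ ↦ (m.wedge x : E [⋀^Fin (2 * j + 3)]→L[ℝ] ℂ))
        (ContinuousAlternatingMap.wedge_add_right _))).addSubgroupOf (integralForms Φ (2 * j + 3))) =
      d (Fin.last (j + 1)) / d 0 := by
  obtain ⟨Φ', hΛ, hs⟩ := hd.exists_isSymplecticEnum Φ
  rw [integralForms_eq_of_range_latticeVec_eq hΛ.symm 1, integralForms_eq_of_range_latticeVec_eq hΛ.symm (2 * j + 3)]
  exact hs.exponent_quotient_map_wedge_integralForms_one_of_eq_content_smul Φ' (hη.of_range_latticeVec_subset hΛ.le) hle₁ hm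

/-- **Any presentation: `N·H^{2g−1}(X, ℤ) ⊆ γ_{g−1} ∧ H¹(X, ℤ) ⟺ d_g/d₁ ∣ N`** (`g = j + 2`).
[cite: Lange2023AbelianVarietiesComplex, §5.4.1 Thm. 5.4.1 and (5.22) (PDF p. 275); §1.5.1 (PDF p. 51)] [cite: VoisinHodgeI2002, §7.2.2 (PDF p. 142 L10)] -/
theorem IsPolarizationType.map_nsmul_le_map_wedge_integralForms_one_iff_of_eq_content_smul {Φ : (ι → ℝ) ≃L[ℝ] E}
    (hd : IsPolarizationType Φ η d) (hη : IsRiemannForm Φ η) (hle₁ : j + 1 ≤ j + 2) {m : E [⋀^Fin (2 * (j + 1))]→L[ℝ] ℂ}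
    (hm : wedgePow (ofRealForm η) (j + 1) = (((j + 1).factorial * ∏ i : Fin (j + 1), d (Fin.castLE hle₁ i) : ℕ) : ℂ) • m) (N : ℕ) :
    (integralForms Φ (2 * j + 3)).map (nsmulAddMonoidHom N) ≤ (integralForms Φ 1).map (AddMonoidHom.mk'
        (fun x : E [⋀^Fin 1]→L[ℝ] ℂ ↦ (m.wedge x : E [⋀^Fin (2 * j + 3)]→L[ℝ] ℂ)) (ContinuousAlternatingMap.wedge_add_right _)) ↔
      d (Fin.last (j + 1)) / d 0 ∣ N :=
  map_nsmul_le_iff_exponent_dvd₄₆ (hd.exponent_quotient_map_wedge_integralForms_one_of_eq_content_smul hη hle₁ hm) N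

/-- **Any presentation: the exponent of `H^{2g−1}(X, ℤ)/γ_{g−2} ∧ H³(X, ℤ)` is `d_{g−1}/d₁`** (`g = j + 2`).
[cite: Lange2023AbelianVarietiesComplex, §5.4.1 Thm. 5.4.1 and (5.22) (PDF p. 275); §1.5.1 (PDF p. 51)] [cite: VoisinHodgeI2002, §7.1.2 (PDF p. 134 L31)] [cite: AdkinsWeintraub1992, Ch. 3 §7 Thm. (7.1) and Rem. (7.10)] -/
theorem IsPolarizationType.exponent_quotient_map_wedge_integralForms_three_of_eq_content_smul {Φ : (ι → ℝ) ≃L[ℝ] E}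
    (hd : IsPolarizationType Φ η d) (hη : IsRiemannForm Φ η) (hle₂ : j ≤ j + 2) {γ : E [⋀^Fin (2 * j)]→L[ℝ] ℂ}
    (hγ : wedgePow (ofRealForm η) j = ((j.factorial * ∏ i : Fin j, d (Fin.castLE hle₂ i) : ℕ) : ℂ) • γ) :
    AddMonoid.exponent (↥(integralForms Φ (2 * j + 3)) ⧸ ((integralForms Φ 3).map (AddMonoidHom.mk'
        (fun x : E [⋀^Fin 3]→L[ℝ] ℂ ↦ γ.wedge x) (ContinuousAlternatingMap.wedge_add_right _))).addSubgroupOf (integralForms Φ (2 * j + 3))) =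
      d (Fin.last j).castSucc / d 0 := by
  obtain ⟨Φ', hΛ, hs⟩ := hd.exists_isSymplecticEnum Φ
  rw [integralForms_eq_of_range_latticeVec_eq hΛ.symm 3, integralForms_eq_of_range_latticeVec_eq hΛ.symm (2 * j + 3)]
  exact hs.exponent_quotient_map_wedge_integralForms_three_of_eq_content_smul Φ' (hη.of_range_latticeVec_subset hΛ.le) hle₂ hγ

/-- **Any presentation: `N·H^{2g−1}(X, ℤ) ⊆ γ_{g−2} ∧ H³(X, ℤ) ⟺ d_{g−1}/d₁ ∣ N`** (`g = j + 2`).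
[cite: Lange2023AbelianVarietiesComplex, §5.4.1 Thm. 5.4.1 and (5.22) (PDF p. 275); §1.5.1 (PDF p. 51)] [cite: VoisinHodgeI2002, §7.1.2 (PDF p. 134 L31)] -/
theorem IsPolarizationType.map_nsmul_le_map_wedge_integralForms_three_iff_of_eq_content_smul {Φ : (ι → ℝ) ≃L[ℝ] E}
    (hd : IsPolarizationType Φ η d) (hη : IsRiemannForm Φ η) (hle₂ : j ≤ j + 2) {γ : E [⋀^Fin (2 * j)]→L[ℝ] ℂ}
    (hγ : wedgePow (ofRealForm η) j = ((j.factorial * ∏ i : Fin j, d (Fin.castLE hle₂ i) : ℕ) : ℂ) • γ) (N : ℕ) :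
    (integralForms Φ (2 * j + 3)).map (nsmulAddMonoidHom N) ≤ (integralForms Φ 3).map (AddMonoidHom.mk'
        (fun x : E [⋀^Fin 3]→L[ℝ] ℂ ↦ γ.wedge x) (ContinuousAlternatingMap.wedge_add_right _)) ↔
      d (Fin.last j).castSucc / d 0 ∣ N :=
  map_nsmul_le_iff_exponent_dvd₄₆ (hd.exponent_quotient_map_wedge_integralForms_three_of_eq_content_smul hη hle₂ hγ) N

/-- **Any presentation, constant type: the exponent of `H^{2g−2}(X, ℤ)/γ_{g−2} ∧ H²(X, ℤ)` is `g − 1`** (`g = j + 2`).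
[cite: Lange2023AbelianVarietiesComplex, §4.2 (PDF p. 204); §5.4.1 Thm. 5.4.1 and (5.22) (PDF p. 275)] [cite: VoisinHodgeI2002, §7.1.2 (PDF p. 134 L31)] [cite: AdkinsWeintraub1992, Ch. 3 §7 Rem. (7.10)] -/
theorem IsPolarizationType.exponent_quotient_map_wedge_integralForms_two_of_forall_eq {Φ : (ι → ℝ) ≃L[ℝ] E}
    (hd : IsPolarizationType Φ η d) (hη : IsRiemannForm Φ η) (hle : j ≤ j + 2) {γ : E [⋀^Fin (2 * j)]→L[ℝ] ℂ}
    (hγ : wedgePow (ofRealForm η) j = ((j.factorial * ∏ i : Fin j, d (Fin.castLE hle i) : ℕ) : ℂ) • γ) (hd₀ : ∀ i, d i = d 0) :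
    AddMonoid.exponent (↥(integralForms Φ (2 * j + 2)) ⧸ ((integralForms Φ 2).map (AddMonoidHom.mk' (fun x : E [⋀^Fin 2]→L[ℝ] ℂ ↦ γ.wedge x)
        (ContinuousAlternatingMap.wedge_add_right _))).addSubgroupOf (integralForms Φ (2 * j + 2))) = j + 1 := by
  obtain ⟨e⟩ := hd.nonempty_addEquiv_quotient_map_wedge_integralForms_two_zmod_of_eq_content_smul hη hle hγ hd₀
  rw [AddMonoid.exponent_eq_of_addEquiv e, ZMod.exponent]

/-- **Any presentation, constant type: `N·H^{2g−2}(X, ℤ) ⊆ γ_{g−2} ∧ H²(X, ℤ) ⟺ g − 1 ∣ N`** (`g = j + 2`).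
[cite: Lange2023AbelianVarietiesComplex, §4.2 (PDF p. 204); §5.4.1 Thm. 5.4.1 and (5.22) (PDF p. 275)] [cite: VoisinHodgeI2002, §7.1.2 (PDF p. 134 L31)] -/
theorem IsPolarizationType.map_nsmul_le_map_wedge_integralForms_two_iff_of_forall_eq {Φ : (ι → ℝ) ≃L[ℝ] E}
    (hd : IsPolarizationType Φ η d) (hη : IsRiemannForm Φ η) (hle : j ≤ j + 2) {γ : E [⋀^Fin (2 * j)]→L[ℝ] ℂ}
    (hγ : wedgePow (ofRealForm η) j = ((j.factorial * ∏ i : Fin j, d (Fin.castLE hle i) : ℕ) : ℂ) • γ) (hd₀ : ∀ i, d i = d 0) (N : ℕ) :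
    (integralForms Φ (2 * j + 2)).map (nsmulAddMonoidHom N) ≤ (integralForms Φ 2).map (AddMonoidHom.mk' (fun x : E [⋀^Fin 2]→L[ℝ] ℂ ↦ γ.wedge x)
        (ContinuousAlternatingMap.wedge_add_right _)) ↔ j + 1 ∣ N :=
  map_nsmul_le_iff_exponent_dvd₄₆ (hd.exponent_quotient_map_wedge_integralForms_two_of_forall_eq hη hle hγ hd₀) N

/-- **Existence form, degree one**: any polarised torus of type `(d₁, …, d_g)` (`g = j + 2`) carries the integral minimal class `γ_{g−1}` with
`N·H^{2g−1}(X, ℤ) ⊆ γ_{g−1} ∧ H¹(X, ℤ) ⟺ d_g/d₁ ∣ N`. [cite: Lange2023AbelianVarietiesComplex, §2.5.3 Thm. 2.5.16 and Cor. 2.5.17 (PDF p. 135); §5.4.1 (5.22) (PDF p. 275); §1.5.1 (PDF p. 51)] [cite: VoisinHodgeI2002, §7.2.2 (PDF p. 142 L10)] -/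
theorem IsPolarizationType.exists_minimalClass_map_nsmul_le_map_wedge_integralForms_one_iff {Φ : (ι → ℝ) ≃L[ℝ] E}
    (hd : IsPolarizationType Φ η d) (hη : IsRiemannForm Φ η) (hle₁ : j + 1 ≤ j + 2) :
    ∃ m ∈ integralForms Φ (2 * (j + 1)),
      wedgePow (ofRealForm η) (j + 1) = (((j + 1).factorial * ∏ i : Fin (j + 1), d (Fin.castLE hle₁ i) : ℕ) : ℂ) • m ∧
      ∀ N : ℕ, (integralForms Φ (2 * j + 3)).map (nsmulAddMonoidHom N) ≤ (integralForms Φ 1).map (AddMonoidHom.mk'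
          (fun x : E [⋀^Fin 1]→L[ℝ] ℂ ↦ (m.wedge x : E [⋀^Fin (2 * j + 3)]→L[ℝ] ℂ)) (ContinuousAlternatingMap.wedge_add_right _)) ↔
        d (Fin.last (j + 1)) / d 0 ∣ N := by
  obtain ⟨m, hmZ, hm⟩ := hd.exists_mem_integralForms_wedgePow_eq_content_smul hle₁
  exact ⟨m, hmZ, hm, fun N ↦ hd.map_nsmul_le_map_wedge_integralForms_one_iff_of_eq_content_smul hη hle₁ hm N⟩

/-- **Existence form, degree three**: any polarised torus of type `(d₁, …, d_g)` (`g = j + 2`) carries the integral minimal class `γ_{g−2}` with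
`N·H^{2g−1}(X, ℤ) ⊆ γ_{g−2} ∧ H³(X, ℤ) ⟺ d_{g−1}/d₁ ∣ N`. [cite: Lange2023AbelianVarietiesComplex, §2.5.3 Thm. 2.5.16 and Cor. 2.5.17 (PDF p. 135); §5.4.1 (5.22) (PDF p. 275); §1.5.1 (PDF p. 51)] [cite: VoisinHodgeI2002, §7.1.2 (PDF p. 134 L31)] -/
theorem IsPolarizationType.exists_minimalClass_map_nsmul_le_map_wedge_integralForms_three_iff {Φ : (ι → ℝ) ≃L[ℝ] E}
    (hd : IsPolarizationType Φ η d) (hη : IsRiemannForm Φ η) (hle₂ : j ≤ j + 2) :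
    ∃ γ ∈ integralForms Φ (2 * j), wedgePow (ofRealForm η) j = ((j.factorial * ∏ i : Fin j, d (Fin.castLE hle₂ i) : ℕ) : ℂ) • γ ∧
      ∀ N : ℕ, (integralForms Φ (2 * j + 3)).map (nsmulAddMonoidHom N) ≤ (integralForms Φ 3).map (AddMonoidHom.mk'
          (fun x : E [⋀^Fin 3]→L[ℝ] ℂ ↦ γ.wedge x) (ContinuousAlternatingMap.wedge_add_right _)) ↔ d (Fin.last j).castSucc / d 0 ∣ N := by
  obtain ⟨γ, hγZ, hγ⟩ := hd.exists_mem_integralForms_wedgePow_eq_content_smul hle₂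
  exact ⟨γ, hγZ, hγ, fun N ↦ hd.map_nsmul_le_map_wedge_integralForms_three_iff_of_eq_content_smul hη hle₂ hγ N⟩

end HardLefschetzExponents

end Literature.Geometry.Kaehler.ComplexTorus
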